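import Literature.MathematicalPhysics.QuantumFieldTheory.Balaban1983to89.B16Ineq17FlatRouteConstants
import Literature.MathematicalPhysics.QuantumFieldTheory.Balaban1983to89.B16Ineq19FlatSliceChart
import Literature.MathematicalPhysics.QuantumFieldTheory.Balaban1983to89.B11Eq177CriticalFamilyDerivative
import Summits.QuantumFields.YangMills.Theorems.BalabanUVNodesN12FlatConstraintPlaquetteJunction

/-!
# BalabanUVNodes ∕ N12 — THE FEDERBUSH FIBRE LETTER `hm` OF THE NEAR-FLAT ONE-SIDED (1.7) SKELETON: for EVERY fine `𝔰𝔲(2)`-valued field `w′` whose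
# k-fold LINEARISED averages reproduce the slice datum `φ(ιA X)` on the plaquette bonds of the window's region (the flat linearised fibre of the datum velocity),
# `((L^d)^k ∕ (L²L²)^k) · circ(X) ≤ D²(A∘expChart 1)(0)(w′, w′)` — `= circ(X)` in `d = 4` — i.e. [Balaban1989LargeFieldII] (1.7) p. 358 at the FLAT background with
# `γ₀ = 1`, read as «`m := γ₀·circ(X)` is dominated by the flat second variation on the whole flat fibre», the binder `hm` of
# `B16Ineq17NearFlatOneSided(Seminorm ∕ WilsonLetters)` (this seat, p593499 ∕ p598593 ∕ p599997)

Cell `pub-ymgap` (HUMAN RULINGS D-0062 ∕ D-0149), width seat `pub-ymgap-dag-n12-w4` g2 (U2c lane, «assembler of the (L2) DISPLAY route at the record»); WORD of the N12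
lane owner dag-n12-c g17 (bus 2026-08-28 02:49Z, ASK-2 = (F)): «type the Federbush `hm` fibre junction yourself … state the fibre letter for EVERY fine `w′` with
`DΦ♭(0) w′ = y`, not only for the right-inverse image».  Key K1⁷ `stmt-QuantumFields-20542`, `--kind proof --supports … --as helper`; count-neutral; THEOREMS ONLY
(0 `def`, 0 `sorry`, 0 `instance`).  Summits-side because it consumes dag-n10-w1's (J-b) module A (a Summits theorem file).  CONSUMED BY NAME, nothing restated:
dag-n12-w4 g0's ★★ `B16Ineq17FlatRouteConstants.gamma0_circ_le_of_flat_chain` (p591325: the localized Federbush chain estimate with the explicit raw-unit `γ₀`) and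
`gamma0_raw_dim4`; dag-n10-w1's (J-b) A `N12FlatConstraintPlaquetteJunction.chainLaw_iterLin_comp_linearMap` ∕ `oc_iterLin_comp_eq_of_reproduce` (p592369: the chain
binders `hY` ∕ `hYk` from the `linAvg`-recursion); dag-n12-w3's `B16Ineq19FlatSliceChart.{exists_lieSU2Coord, expMul_su2Chart_smul_one_eq_expChart,
deriv_deriv_wilsonAction4_expMul_su2Chart_one}` (p590268: the flat second variation along the slice chart IS the `ℝ³` curl energy `Σ_p ‖oc‖²`) and
`B11Eq177CriticalFamilyDerivative.deriv_deriv_wilsonAction4_expChart_smul_eq` (p588036: ray second derivative = Fréchet Hessian diagonal); dag-n12-w1's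
`B15SU2ChartHolomorphic.{genE, quatMatrix_imQuat, trace_genE_mul_genE, genE_trace, star_genE, decomp_genE}` (p588458: the Pauli-type basis of `M₂(ℂ)`).

THE PRINT.  [Balaban1989LargeFieldII] p. 357: «The leading term in the expansion is the quadratic form with the background field identically equal to 1 … Now the
leading quadratic form is equal to ⟨B′, Δ_kB′⟩ defined by (1.65), (1.66) [10]. Using the bound (1.67) [10] for this form, we obtain (1.7)»; [Balaban1984PropagatorsI]
(1.64)–(1.67) p. 29 (`⟨B′, Δ_kB′⟩ = inf{½⟨∂A, ∂A⟩ : Q_kA = B′, …}` and its lower bound); [Federbush1986PhaseCellI] 'Abelian Stability Theorem' (0.12) p. 321 («averaging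
decreases the action»); [Balaban1985Variational] (45) p. 285 («L^jηQ_jHB = B on Λ_j»).  HERE: the infimum's competitor set is the whole flat linearised fibre — every
fine `w′` with `Q^{(k)}w′ = φ(ιA X)` on the region — and the lower bound is the window circulation sum of the slice vector with the raw-unit constant of p591325.

THE `ℝ³` COORDINATE OF A MATRIX (no definition introduced: an `∃`).  §1 proves there is an ℝ-linear `ψ : M₂(ℂ) → ℝ³` with `ψ(quatMatrix (ι v)) = v` and
`quatMatrix (ι (ψ Z)) = Z` for every `Z ∈ 𝔰𝔲(2)` (`ψ(M)_a = Re(−½ tr(E_a M))`, by `tr(E_aE_b) = −2δ_{ab}` and `decomp_genE`; on `𝔰𝔲(2)` the coefficients are real and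
`tr Z = 0`) — the inverse of dag-n12-w3's coordinate `φ` (`↑(φ v) = quatMatrix (ι v)`), so that the `𝔰𝔲(2)`-valued chain `Q^{(i)}w′` is read in g0's `ℝ³` currency.

CONTENTS.
§1 `exists_su2ReCoord` (the coordinate `ψ`), `lieSU2Coord_reCoord_eq` (`φ (ψ ↑Z) = Z` on `𝔰𝔲(2)` for any `φ` with `hφ`).
§2 ★★★ `gamma0_circ_le_secondVariation_flat_of_reproduce` — THE FIBRE LETTER: data = g0's window ∕ region binders (`box m lo` non-wrapping, nested plaquette-site sets
   `S_i` with the window's image inside `S_k`) + the `linAvg`-recursion letter `Q` + ONE fine field `w′ : bonds → 𝔰𝔲(2)` whose `Q^{(k)}` reproduces `φ(ιA X)` on the four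
   bonds of every `(e₀, e_ν)`-plaquette at the sites of `S_k` ⇒ `((L^d)^k ∕ (L²·L²)^k) · circ(X) ≤ d²∕ds² A(1·e^{s w′})∣₀`; `gamma0_circ_le_flatHessian_of_reproduce` (the same against the Fréchet
   Hessian diagonal `D²(A∘expChart 1)(0)(w′, w′)` — the `B♭ w′ w′` of the skeleton); `circ_le_flatHessian_of_reproduce_dim4` (`d = 4`: constant `1`).
§3 ★★ `hm_federbush_of_reproduce` — THE SKELETON's BINDER SHAPE: «`∀ w′, (reproduction on the region) → γ₀^{raw}·circ(X) ≤ B♭ w′ w′`» packaged as one statement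
   (the consumer specialises the antecedent from `DΦ♭(0) w′ = y` by dag-n10-w1's (J-b) B `fderiv_msChart_one_apply_eq_iterLin` on the constrained bonds of the region —
   that dictionary between the region's plaquette bonds and `𝔹`'s level-`k` constrained bonds is the :395 consumer's (t7) or a follow-up, not here).

HONEST FRAMING.  Junction algebra BY NAME over landed kernel theorems; the region sets `S_i` and their nesting, the recursion letter `Q` (inhabited:
`N12FlatConstraintPlaquetteJunction.exists_rightInverse_iterLin_fun`'s family ∕ `ChartHInv.exists_linFamily`), and the reproduction on the region are DISPLAYED hypotheses;
the weight is `ζ ≡ 1` (the bare Wilson action of record carries no `ζ₀`-cut-off); nothing of Bałaban's (1.65)–(1.67) ∕ (1.7) is asserted beyond this kernel inequality;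
N12 NOT discharged; K1⁷ NOT closed; count-neutral (typed 28∕28 · discharged 5∕27 unmoved); one finite 𝕋⁴ programme at fixed ε — R4 closes the conditional rung
`BalabanLadder.UV` only; the YM mass gap (Clay) is NOT proved by any of this.  No `sorry`, no `def`, no `instance`, no `notation`.
-/

noncomputable section

open scoped BigOperators Matrix.Norms.L2Operator
open Finset

namespace Summit.QuantumFields.YangMills.BalabanUVNodes.N12NearFlatFederbushFibre

open Literature.MathematicalPhysics.QuantumFieldTheory.Balaban1983to89
open Literature.MathematicalPhysics.QuantumLattice (quatMatrix)
open T4HaarSU2ExpChart (imQuat imQuat_apply)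
open T4AdjointCovarianceUnitary (lieSU mem_lieSU_iff)
open T4CubeChartGnomonic (SU2)
open B15Prop1ChartSU2 (su2Chart)
open B16Sect1Backgrounds (expMul)
open B15DeterminingSets GaugeField
open B15Prop1SliceCoordinates (GaugeSlice ιA)
open T4AxialGaugeSmallField (castSite)
open B6TreeGaugePoincare (curl)
open B16Eq18Proof (box)
open LatticeFieldCalculus (bondAvg runSite)
open B6StairStokesTorus (oc)
open B15SU2ChartHolomorphic (genE quatMatrix_imQuat trace_genE_mul_genE genE_trace star_genE decomp_genE)
open B16Ineq19FlatSliceChart (exists_lieSU2Coord expMul_su2Chart_smul_one_eq_expChart deriv_deriv_wilsonAction4_expMul_su2Chart_one)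
open B16Ineq17FlatRouteConstants (gamma0_circ_le_of_flat_chain gamma0_raw_dim4)
open B11Eq177CriticalFamilyDerivative (deriv_deriv_wilsonAction4_expChart_smul_eq)
open BlockAveragingEMLLinearised (linAvg)
open Node00 (SU expChart)
open Summit.QuantumFields.YangMills.BalabanUVNodes.N12FlatConstraintPlaquetteJunction (chainLaw_iterLin_comp_linearMap oc_iterLin_comp_eq_of_reproduce)

/-! ## §1  The `ℝ³` coordinate of a `2 × 2` matrix (inverse of the slice chain's `φ` on `𝔰𝔲(2)`) -/

section Coordinate

/-- For a skew-Hermitian `Z` (in particular `Z ∈ 𝔰𝔲(2)`) the Pauli coefficient `tr(E_a Z)` is REAL (`(E_aZ)⋆ = ZE_a`, `tr` cyclic).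
[cite: Balaban1989LargeFieldII, (1.19) p.360 (bookkeeping)] -/
theorem im_trace_genE_mul_eq_zero {Z : Matrix (Fin 2) (Fin 2) ℂ} (hZ : star Z = -Z) (a : Fin 3) : ((genE a * Z).trace).im = 0 := by
  have h1 : Matrix.trace (star (genE a * Z)) = star (Matrix.trace (genE a * Z)) := Matrix.trace_conjTranspose _
  have h2 : star (genE a * Z) = Z * genE a := by
    rw [star_mul, hZ, star_genE, neg_mul_neg]
  rw [h2, Matrix.trace_mul_comm] at h1
  have h3 := congrArg Complex.im h1
  rw [Complex.star_def, Complex.conj_im] at h3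
  linarith

/-- ★ **THE `ℝ³` COORDINATE `ψ` OF `M₂(ℂ)`** (inverse of dag-n12-w3's `φ : ℝ³ → 𝔰𝔲(2)`, `↑(φ v) = quatMatrix (ι v) = Σ_a v_a E_a`): there is an ℝ-linear
`ψ : M₂(ℂ) → ℝ³` with `ψ (quatMatrix (ι v)) = v` for every `v` and `quatMatrix (ι (ψ Z)) = Z` for every `Z ∈ 𝔰𝔲(2)` — `ψ(M)_a = Re(−½ tr(E_a M))`
(`tr(E_aE_b) = −2δ_{ab}`, `tr E_a = 0`, the decomposition `M = ½tr(M)·1 − ½Σ_a tr(E_aM)·E_a`, and on `𝔰𝔲(2)`: `tr Z = 0`, `tr(E_aZ) ∈ ℝ`).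
[cite: Balaban1989LargeFieldII, (1.19) p.360; Balaban1985Averaging, (17) p.21 (bookkeeping)] -/
theorem exists_su2ReCoord :
    ∃ ψ : Matrix (Fin 2) (Fin 2) ℂ →ₗ[ℝ] EuclideanSpace ℝ (Fin 3),
      (∀ v : EuclideanSpace ℝ (Fin 3), ψ (quatMatrix (imQuat v)) = v) ∧
        ∀ Z : lieSU (Fin 2), quatMatrix (imQuat (ψ (Z : Matrix (Fin 2) (Fin 2) ℂ))) = (Z : Matrix (Fin 2) (Fin 2) ℂ) := by
  let ψ : Matrix (Fin 2) (Fin 2) ℂ →ₗ[ℝ] EuclideanSpace ℝ (Fin 3) :=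
    { toFun := fun M => WithLp.toLp 2 fun a => (-(1 / 2 : ℂ) * (genE a * M).trace).re
      map_add' := fun M M' => by
        ext a
        simp only [PiLp.add_apply, Matrix.trace_add, mul_add, Complex.add_re]
      map_smul' := fun c M => by
        ext a
        simp only [PiLp.smul_apply, smul_eq_mul, RingHom.id_apply, Matrix.mul_smul, Matrix.trace_smul, Complex.real_smul]
        show (-(1 / 2 : ℂ) * ((c : ℂ) * (genE a * M).trace)).re = c * (-(1 / 2 : ℂ) * (genE a * M).trace).re
        rw [show -(1 / 2 : ℂ) * ((c : ℂ) * (genE a * M).trace) = (c : ℂ) * (-(1 / 2 : ℂ) * (genE a * M).trace) by ring,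
          Complex.re_ofReal_mul] }
  have hψ : ∀ M a, ψ M a = (-(1 / 2 : ℂ) * (genE a * M).trace).re := fun M a => rfl
  refine ⟨ψ, fun v => ?_, fun Z => ?_⟩
  · ext a
    rw [hψ, quatMatrix_imQuat, Finset.mul_sum, Matrix.trace_sum]
    simp only [Matrix.mul_smul, Matrix.trace_smul, trace_genE_mul_genE, smul_eq_mul, mul_ite, mul_neg, mul_zero,
      Finset.sum_ite_eq, Finset.mem_univ, if_true]
    simp only [Complex.mul_re, Complex.neg_re, Complex.neg_im, Complex.ofReal_re, Complex.ofReal_im]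
    norm_num; ring
  · obtain ⟨hskew, htr⟩ := mem_lieSU_iff.mp Z.2
    have hreal : ∀ a : Fin 3, (((-(1 / 2 : ℂ) * (genE a * (Z : Matrix (Fin 2) (Fin 2) ℂ)).trace).re : ℝ) : ℂ)
        = -(1 / 2 : ℂ) * (genE a * (Z : Matrix (Fin 2) (Fin 2) ℂ)).trace := fun a => by
      apply Complex.ext
      · simp
      · rw [Complex.ofReal_im, Complex.mul_im, im_trace_genE_mul_eq_zero hskew a]
        simp
    rw [quatMatrix_imQuat]
    have hsum : ∑ a : Fin 3, (((ψ (Z : Matrix (Fin 2) (Fin 2) ℂ)) a : ℝ) : ℂ) • genE a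
        = ∑ a : Fin 3, (-(1 / 2 : ℂ) * (genE a * (Z : Matrix (Fin 2) (Fin 2) ℂ)).trace) • genE a :=
      Finset.sum_congr rfl fun a _ => by rw [hψ, hreal]
    rw [hsum]
    have hdec := decomp_genE (Z : Matrix (Fin 2) (Fin 2) ℂ)
    rw [htr, mul_zero, zero_smul, zero_add] at hdec
    exact hdec

/-- **`ψ` INVERTS `φ` ON `𝔰𝔲(2)`**: for any coordinate `φ` with `↑(φ v) = quatMatrix (ι v)` and any `ψ` as in `exists_su2ReCoord`, `φ (ψ ↑Z) = Z` for `Z ∈ 𝔰𝔲(2)`.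
[cite: Balaban1989LargeFieldII, (1.19) p.360 (bookkeeping)] -/
theorem lieSU2Coord_reCoord_eq {φ : EuclideanSpace ℝ (Fin 3) →ₗ[ℝ] lieSU (Fin 2)}
    (hφ : ∀ v, ((φ v : lieSU (Fin 2)) : Matrix (Fin 2) (Fin 2) ℂ) = quatMatrix (imQuat v))
    {ψ : Matrix (Fin 2) (Fin 2) ℂ →ₗ[ℝ] EuclideanSpace ℝ (Fin 3)}
    (hψZ : ∀ Z : lieSU (Fin 2), quatMatrix (imQuat (ψ (Z : Matrix (Fin 2) (Fin 2) ℂ))) = (Z : Matrix (Fin 2) (Fin 2) ℂ)) (Z : lieSU (Fin 2)) :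
    φ (ψ (Z : Matrix (Fin 2) (Fin 2) ℂ)) = Z :=
  Subtype.ext (by rw [hφ, hψZ])

end Coordinate

/-! ## §2  The Federbush fibre letter -/

section Fibre

variable {P : Params} {k : ℕ} [DecidableEq (PBond P k)]

/-- ★★★ **THE FEDERBUSH FIBRE LETTER** — [LF-II] (1.7) at the FLAT background with `γ₀ = 1`, for EVERY competitor of the flat linearised fibre.  DATA (all displayed):
the slice vector `X ∈ GaugeSlice S T ℝ³` at level `k`, a non-wrapping window `box m lo`, nested plaquette-site sets `S_i` with the window's `castSite`-image inside `S_k`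
(g0's region binders verbatim), the `linAvg`-recursion letter `Q` (`Q 0 = id`, `Q (i+1) = linAvg ∘ Q i`), a coordinate `φ : ℝ³ → 𝔰𝔲(2)`, and ONE fine field
`w′ : bonds → 𝔰𝔲(2)` whose k-fold linearised averages REPRODUCE `φ(ιA X)` on the four bonds of every `(e₀, e_ν)`-plaquette at the sites of `S_k` («`Q_k w′ = B′` near `Λ`»,
[15] (45)).  THEN `((L^d)^k ∕ (L²·L²)^k) · circ(X) ≤ d²∕ds² A(1·e^{s w′})∣₀` — the chain `Y_i := ψ ∘ Q^{(i)}w′` of g0's `gamma0_circ_le_of_flat_chain` with `c = L`, `ζ ≡ 1`,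
`κ = 2`, its `hflat` being dag-n12-w3's identity «flat second variation along the slice chart = `Σ_p ‖oc‖²`».
[cite: Balaban1989LargeFieldII, (1.7) pp.357–358; Balaban1984PropagatorsI, (1.64)–(1.67) p.29; Federbush1986PhaseCellI, 'Abelian Stability Theorem' (0.12) p.321; Balaban1985Variational, (45) p.285] -/
theorem gamma0_circ_le_secondVariation_flat_of_reproduce (h0 : 0 < P.d) (hk : k ≤ P.m + P.K) {S : Set (Site P k)} {T : Finset (PBond P k)}
    (X : GaugeSlice S T (EuclideanSpace ℝ (Fin 3))) {m : Fin P.d → ℕ} (lo : Fin P.d → ℤ) (hm : ∀ κ, (m κ : ℤ) ≤ P.sitesPerDir k)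
    (Sset : (i : ℕ) → Finset (Site P i)) (hwin : ∀ z ∈ box m lo, (castSite z : Site P k) ∈ Sset k)
    (hS : ∀ (ν : Fin P.d), (⟨0, h0⟩ : Fin P.d) ≠ ν → ∀ i, i < k → ∀ y ∈ Sset (i + 1), ∀ (r : Fin P.d → Fin P.L) (s t : ℕ),
      s < P.L → t < P.L → runSite (runSite (Site.blockSite y r) ⟨0, h0⟩ s) ν t ∈ Sset i)
    (Q : (i : ℕ) → (PBond P 0 → Matrix (Fin 2) (Fin 2) ℂ) → PBond P i → Matrix (Fin 2) (Fin 2) ℂ) (hQ0 : ∀ Y, Q 0 Y = Y)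
    (hQs : ∀ (i : ℕ) (Y : PBond P 0 → Matrix (Fin 2) (Fin 2) ℂ) (c : PBond P (i + 1)), Q (i + 1) Y c = linAvg (Q i Y) c)
    {φ : EuclideanSpace ℝ (Fin 3) →ₗ[ℝ] lieSU (Fin 2)} (hφ : ∀ v, ((φ v : lieSU (Fin 2)) : Matrix (Fin 2) (Fin 2) ℂ) = quatMatrix (imQuat v))
    (w' : PBond P 0 → lieSU (Fin 2))
    (hrep : ∀ (ν : Fin P.d), ∀ y ∈ Sset k,
      Q k (fun b => (w' b : Matrix (Fin 2) (Fin 2) ℂ)) ⟨y, ⟨0, h0⟩⟩ = ((φ (ιA S T X ⟨y, ⟨0, h0⟩⟩) : lieSU (Fin 2)) : Matrix (Fin 2) (Fin 2) ℂ) ∧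
      Q k (fun b => (w' b : Matrix (Fin 2) (Fin 2) ℂ)) ⟨y.shift ⟨0, h0⟩, ν⟩ = ((φ (ιA S T X ⟨y.shift ⟨0, h0⟩, ν⟩) : lieSU (Fin 2)) : Matrix (Fin 2) (Fin 2) ℂ) ∧
      Q k (fun b => (w' b : Matrix (Fin 2) (Fin 2) ℂ)) ⟨y.shift ν, ⟨0, h0⟩⟩ = ((φ (ιA S T X ⟨y.shift ν, ⟨0, h0⟩⟩) : lieSU (Fin 2)) : Matrix (Fin 2) (Fin 2) ℂ) ∧
      Q k (fun b => (w' b : Matrix (Fin 2) (Fin 2) ℂ)) ⟨y, ν⟩ = ((φ (ιA S T X ⟨y, ν⟩) : lieSU (Fin 2)) : Matrix (Fin 2) (Fin 2) ℂ)) :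
    ((P.L : ℝ) ^ P.d) ^ k / (((P.L : ℝ)) ^ 2 * (P.L : ℝ) ^ 2) ^ k *
        ∑ z ∈ box m lo, ∑ μ : Fin P.d, ∑ a : Fin 3, curl (fun b => ιA S T X (⟨castSite b.1, b.2⟩ : PBond P k) a) z ⟨0, h0⟩ μ ^ 2
      ≤ deriv (deriv fun s : ℝ => wilsonAction4 (expChart (1 : GaugeField P 0 (SU 2)) (s • w'))) 0 := by
  classical
  obtain ⟨ψ, hψv, hψZ⟩ := exists_su2ReCoord
  -- the `ℝ³`-valued chain `Y_i := ψ ∘ Q^{(i)} w′`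
  set A : PBond P 0 → Matrix (Fin 2) (Fin 2) ℂ := fun b => (w' b : Matrix (Fin 2) (Fin 2) ℂ) with hA
  set Y : (i : ℕ) → VecField P i (EuclideanSpace ℝ (Fin 3)) := fun i b => ψ (Q i A b) with hY
  have hL : (P.L : ℝ) ≠ 0 := by exact_mod_cast P.L_pos.ne'
  -- `hY`: the chain law `oc (Y (i+1)) = L • oc (bondAvg (Y i))` on every plaquette
  have hchain : ∀ (ν : Fin P.d), (⟨0, h0⟩ : Fin P.d) ≠ ν → ∀ i, i < k → ∀ y ∈ Sset (i + 1),
      oc (Y (i + 1)) ⟨0, h0⟩ ν y = (P.L : ℝ) • oc (bondAvg (Y i)) ⟨0, h0⟩ ν y :=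
    fun ν _ i _ y _ => chainLaw_iterLin_comp_linearMap Q hQs ψ A i ⟨0, h0⟩ ν y
  -- `hYk`: the top member has the plaquette variables of `ιA X` on the region
  have hψφ : ∀ v : EuclideanSpace ℝ (Fin 3), ψ (((φ v : lieSU (Fin 2)) : Matrix (Fin 2) (Fin 2) ℂ)) = v := fun v => by rw [hφ, hψv]
  have htop : ∀ (ν : Fin P.d), ∀ y ∈ Sset k, oc (Y k) ⟨0, h0⟩ ν y = oc (ιA S T X) ⟨0, h0⟩ ν y := by
    intro ν y hy
    obtain ⟨h1, h2, h3, h4⟩ := hrep ν y hy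
    have h := oc_iterLin_comp_eq_of_reproduce Q ψ A (fun b => ((φ (ιA S T X b) : lieSU (Fin 2)) : Matrix (Fin 2) (Fin 2) ℂ)) ⟨0, h0⟩ ν y h1 h2 h3 h4
    rw [hY]
    simp only at h ⊢
    rw [h]
    simp only [oc, hψφ]
  -- the flat value: `w′ = φ ∘ (Y 0)` and dag-n12-w3's curl-energy identity
  have hw' : (fun b => φ (Y 0 b)) = w' := funext fun b => by
    rw [hY]
    simp only [hQ0, hA]
    exact lieSU2Coord_reCoord_eq hφ hψZ (w' b)
  have hflat_eq : deriv (deriv fun s : ℝ => wilsonAction4 (expChart (1 : GaugeField P 0 (SU 2)) (s • w'))) 0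
      = ∑ p : Plaq P 0, ‖oc (Y 0) p.μ p.ν p.src‖ ^ 2 := by
    have h1 : (fun s : ℝ => wilsonAction4 (expChart (1 : GaugeField P 0 (SU 2)) (s • w')))
        = fun s : ℝ => wilsonAction4 (expMul su2Chart (s • Y 0) (1 : GaugeField P 0 SU2)) := by
      funext s
      rw [expMul_su2Chart_smul_one_eq_expChart hφ, hw']
    rw [h1, deriv_deriv_wilsonAction4_expMul_su2Chart_one]
    rfl
  have hflat : (2 : ℝ) / 2 * ∑ q : Plaq P 0, (fun _ : Site P 0 => (1 : ℝ)) q.src * ‖oc (Y 0) q.μ q.ν q.src‖ ^ 2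
      ≤ deriv (deriv fun s : ℝ => wilsonAction4 (expChart (1 : GaugeField P 0 (SU 2)) (s • w'))) 0 := by
    rw [hflat_eq]
    simp only [one_mul]
    norm_num
  have h := gamma0_circ_le_of_flat_chain h0 hk X lo hm hL (by norm_num : (0 : ℝ) < 2) Y Sset hwin htop hS hchain
    (fun _ => (1 : ℝ)) (fun _ => zero_le_one) (fun _ _ => le_rfl) hflat
  have h2 : (2 : ℝ) / 2 = 1 := by norm_num
  rw [h2, one_mul] at h
  exact h

/-- **THE SAME AGAINST THE FRÉCHET HESSIAN DIAGONAL** `B♭ w′ w′ = D²(A∘expChart 1)(0)(w′, w′)` (dag-n12-w3's ray identity) — the currency of the skeleton's `hm` binder.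
[cite: Balaban1989LargeFieldII, (1.7) p.358, (1.12) p.359; Balaban1984PropagatorsI, (1.64)–(1.67) p.29] -/
theorem gamma0_circ_le_flatHessian_of_reproduce (h0 : 0 < P.d) (hk : k ≤ P.m + P.K) {S : Set (Site P k)} {T : Finset (PBond P k)}
    (X : GaugeSlice S T (EuclideanSpace ℝ (Fin 3))) {m : Fin P.d → ℕ} (lo : Fin P.d → ℤ) (hm : ∀ κ, (m κ : ℤ) ≤ P.sitesPerDir k)
    (Sset : (i : ℕ) → Finset (Site P i)) (hwin : ∀ z ∈ box m lo, (castSite z : Site P k) ∈ Sset k)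
    (hS : ∀ (ν : Fin P.d), (⟨0, h0⟩ : Fin P.d) ≠ ν → ∀ i, i < k → ∀ y ∈ Sset (i + 1), ∀ (r : Fin P.d → Fin P.L) (s t : ℕ),
      s < P.L → t < P.L → runSite (runSite (Site.blockSite y r) ⟨0, h0⟩ s) ν t ∈ Sset i)
    (Q : (i : ℕ) → (PBond P 0 → Matrix (Fin 2) (Fin 2) ℂ) → PBond P i → Matrix (Fin 2) (Fin 2) ℂ) (hQ0 : ∀ Y, Q 0 Y = Y)
    (hQs : ∀ (i : ℕ) (Y : PBond P 0 → Matrix (Fin 2) (Fin 2) ℂ) (c : PBond P (i + 1)), Q (i + 1) Y c = linAvg (Q i Y) c)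
    {φ : EuclideanSpace ℝ (Fin 3) →ₗ[ℝ] lieSU (Fin 2)} (hφ : ∀ v, ((φ v : lieSU (Fin 2)) : Matrix (Fin 2) (Fin 2) ℂ) = quatMatrix (imQuat v))
    (w' : PBond P 0 → lieSU (Fin 2))
    (hrep : ∀ (ν : Fin P.d), ∀ y ∈ Sset k,
      Q k (fun b => (w' b : Matrix (Fin 2) (Fin 2) ℂ)) ⟨y, ⟨0, h0⟩⟩ = ((φ (ιA S T X ⟨y, ⟨0, h0⟩⟩) : lieSU (Fin 2)) : Matrix (Fin 2) (Fin 2) ℂ) ∧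
      Q k (fun b => (w' b : Matrix (Fin 2) (Fin 2) ℂ)) ⟨y.shift ⟨0, h0⟩, ν⟩ = ((φ (ιA S T X ⟨y.shift ⟨0, h0⟩, ν⟩) : lieSU (Fin 2)) : Matrix (Fin 2) (Fin 2) ℂ) ∧
      Q k (fun b => (w' b : Matrix (Fin 2) (Fin 2) ℂ)) ⟨y.shift ν, ⟨0, h0⟩⟩ = ((φ (ιA S T X ⟨y.shift ν, ⟨0, h0⟩⟩) : lieSU (Fin 2)) : Matrix (Fin 2) (Fin 2) ℂ) ∧
      Q k (fun b => (w' b : Matrix (Fin 2) (Fin 2) ℂ)) ⟨y, ν⟩ = ((φ (ιA S T X ⟨y, ν⟩) : lieSU (Fin 2)) : Matrix (Fin 2) (Fin 2) ℂ)) :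
    ((P.L : ℝ) ^ P.d) ^ k / (((P.L : ℝ)) ^ 2 * (P.L : ℝ) ^ 2) ^ k *
        ∑ z ∈ box m lo, ∑ μ : Fin P.d, ∑ a : Fin 3, curl (fun b => ιA S T X (⟨castSite b.1, b.2⟩ : PBond P k) a) z ⟨0, h0⟩ μ ^ 2
      ≤ fderiv ℝ (fun Y => fderiv ℝ (fun Y : PBond P 0 → lieSU (Fin 2) => wilsonAction4 (expChart (1 : GaugeField P 0 (SU 2)) Y)) Y) 0 w' w' := by
  rw [← deriv_deriv_wilsonAction4_expChart_smul_eq]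
  exact gamma0_circ_le_secondVariation_flat_of_reproduce h0 hk X lo hm Sset hwin hS Q hQ0 hQs hφ w' hrep

/-- **IN FOUR DIMENSIONS THE CONSTANT IS `1`** (`(L^4)^k ∕ (L²L²)^k = 1`, g0's `gamma0_raw_dim4` — the marginal dimension): `circ(X) ≤ D²(A∘expChart 1)(0)(w′, w′)`.
[cite: Balaban1989LargeFieldII, (1.7) p.358; Federbush1986PhaseCellI, (1.8)–(1.9) p.323] -/
theorem circ_le_flatHessian_of_reproduce_dim4 (hd : P.d = 4) (h0 : 0 < P.d) (hk : k ≤ P.m + P.K) {S : Set (Site P k)} {T : Finset (PBond P k)}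
    (X : GaugeSlice S T (EuclideanSpace ℝ (Fin 3))) {m : Fin P.d → ℕ} (lo : Fin P.d → ℤ) (hm : ∀ κ, (m κ : ℤ) ≤ P.sitesPerDir k)
    (Sset : (i : ℕ) → Finset (Site P i)) (hwin : ∀ z ∈ box m lo, (castSite z : Site P k) ∈ Sset k)
    (hS : ∀ (ν : Fin P.d), (⟨0, h0⟩ : Fin P.d) ≠ ν → ∀ i, i < k → ∀ y ∈ Sset (i + 1), ∀ (r : Fin P.d → Fin P.L) (s t : ℕ),
      s < P.L → t < P.L → runSite (runSite (Site.blockSite y r) ⟨0, h0⟩ s) ν t ∈ Sset i)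
    (Q : (i : ℕ) → (PBond P 0 → Matrix (Fin 2) (Fin 2) ℂ) → PBond P i → Matrix (Fin 2) (Fin 2) ℂ) (hQ0 : ∀ Y, Q 0 Y = Y)
    (hQs : ∀ (i : ℕ) (Y : PBond P 0 → Matrix (Fin 2) (Fin 2) ℂ) (c : PBond P (i + 1)), Q (i + 1) Y c = linAvg (Q i Y) c)
    {φ : EuclideanSpace ℝ (Fin 3) →ₗ[ℝ] lieSU (Fin 2)} (hφ : ∀ v, ((φ v : lieSU (Fin 2)) : Matrix (Fin 2) (Fin 2) ℂ) = quatMatrix (imQuat v))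
    (w' : PBond P 0 → lieSU (Fin 2))
    (hrep : ∀ (ν : Fin P.d), ∀ y ∈ Sset k,
      Q k (fun b => (w' b : Matrix (Fin 2) (Fin 2) ℂ)) ⟨y, ⟨0, h0⟩⟩ = ((φ (ιA S T X ⟨y, ⟨0, h0⟩⟩) : lieSU (Fin 2)) : Matrix (Fin 2) (Fin 2) ℂ) ∧
      Q k (fun b => (w' b : Matrix (Fin 2) (Fin 2) ℂ)) ⟨y.shift ⟨0, h0⟩, ν⟩ = ((φ (ιA S T X ⟨y.shift ⟨0, h0⟩, ν⟩) : lieSU (Fin 2)) : Matrix (Fin 2) (Fin 2) ℂ) ∧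
      Q k (fun b => (w' b : Matrix (Fin 2) (Fin 2) ℂ)) ⟨y.shift ν, ⟨0, h0⟩⟩ = ((φ (ιA S T X ⟨y.shift ν, ⟨0, h0⟩⟩) : lieSU (Fin 2)) : Matrix (Fin 2) (Fin 2) ℂ) ∧
      Q k (fun b => (w' b : Matrix (Fin 2) (Fin 2) ℂ)) ⟨y, ν⟩ = ((φ (ιA S T X ⟨y, ν⟩) : lieSU (Fin 2)) : Matrix (Fin 2) (Fin 2) ℂ)) :
    ∑ z ∈ box m lo, ∑ μ : Fin P.d, ∑ a : Fin 3, curl (fun b => ιA S T X (⟨castSite b.1, b.2⟩ : PBond P k) a) z ⟨0, h0⟩ μ ^ 2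
      ≤ fderiv ℝ (fun Y => fderiv ℝ (fun Y : PBond P 0 → lieSU (Fin 2) => wilsonAction4 (expChart (1 : GaugeField P 0 (SU 2)) Y)) Y) 0 w' w' := by
  have h := gamma0_circ_le_flatHessian_of_reproduce h0 hk X lo hm Sset hwin hS Q hQ0 hQs hφ w' hrep
  rwa [gamma0_raw_dim4 hd k, one_mul] at h

end Fibre

/-! ## §3  The skeleton's binder shape `hm` -/

section Binder

variable {P : Params} {k : ℕ} [DecidableEq (PBond P k)]

/-- ★★ **THE `hm` BINDER OF THE NEAR-FLAT SKELETON, INHABITED ON THE FLAT LINEARISED FIBRE**: with `m := ((L^d)^k ∕ (L²L²)^k)·circ(X)` and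
`B♭ := D²(A∘expChart 1)(0)`, «`∀ w′`, (the k-fold linearised averages of `w′` reproduce `φ(ιA X)` on the region) `→ m ≤ B♭ w′ w′`» — the shape
`∀ w′, L♭ w′ = y → m ≤ B♭ w′ w′` of `B16Ineq17NearFlatOneSidedSeminorm.lagrangeHessian_ge_flatMin_sub_seminorm` ∕ `B16Ineq17NearFlatWilsonLetters.hessian_wilsonAction4_criticalExpChartFamily_ge_flatMin_sub`
once the consumer reads `L♭ w′ = y` (`L♭ = DΦ♭(0)`, `Φ♭` the flat multi-scale chart) as the reproduction on the region's constrained bonds (dag-n10-w1's (J-b) B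
`fderiv_msChart_one_apply_eq_iterLin`). [cite: Balaban1989LargeFieldII, (1.7) pp.357–358; Balaban1984PropagatorsI, (1.64)–(1.67) p.29; Balaban1985Variational, (45) p.285] -/
theorem hm_federbush_of_reproduce (h0 : 0 < P.d) (hk : k ≤ P.m + P.K) {S : Set (Site P k)} {T : Finset (PBond P k)}
    (X : GaugeSlice S T (EuclideanSpace ℝ (Fin 3))) {m : Fin P.d → ℕ} (lo : Fin P.d → ℤ) (hm : ∀ κ, (m κ : ℤ) ≤ P.sitesPerDir k)
    (Sset : (i : ℕ) → Finset (Site P i)) (hwin : ∀ z ∈ box m lo, (castSite z : Site P k) ∈ Sset k)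
    (hS : ∀ (ν : Fin P.d), (⟨0, h0⟩ : Fin P.d) ≠ ν → ∀ i, i < k → ∀ y ∈ Sset (i + 1), ∀ (r : Fin P.d → Fin P.L) (s t : ℕ),
      s < P.L → t < P.L → runSite (runSite (Site.blockSite y r) ⟨0, h0⟩ s) ν t ∈ Sset i)
    (Q : (i : ℕ) → (PBond P 0 → Matrix (Fin 2) (Fin 2) ℂ) → PBond P i → Matrix (Fin 2) (Fin 2) ℂ) (hQ0 : ∀ Y, Q 0 Y = Y)
    (hQs : ∀ (i : ℕ) (Y : PBond P 0 → Matrix (Fin 2) (Fin 2) ℂ) (c : PBond P (i + 1)), Q (i + 1) Y c = linAvg (Q i Y) c)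
    {φ : EuclideanSpace ℝ (Fin 3) →ₗ[ℝ] lieSU (Fin 2)} (hφ : ∀ v, ((φ v : lieSU (Fin 2)) : Matrix (Fin 2) (Fin 2) ℂ) = quatMatrix (imQuat v)) :
    ∀ w' : PBond P 0 → lieSU (Fin 2),
      (∀ (ν : Fin P.d), ∀ y ∈ Sset k,
        Q k (fun b => (w' b : Matrix (Fin 2) (Fin 2) ℂ)) ⟨y, ⟨0, h0⟩⟩ = ((φ (ιA S T X ⟨y, ⟨0, h0⟩⟩) : lieSU (Fin 2)) : Matrix (Fin 2) (Fin 2) ℂ) ∧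
        Q k (fun b => (w' b : Matrix (Fin 2) (Fin 2) ℂ)) ⟨y.shift ⟨0, h0⟩, ν⟩ = ((φ (ιA S T X ⟨y.shift ⟨0, h0⟩, ν⟩) : lieSU (Fin 2)) : Matrix (Fin 2) (Fin 2) ℂ) ∧
        Q k (fun b => (w' b : Matrix (Fin 2) (Fin 2) ℂ)) ⟨y.shift ν, ⟨0, h0⟩⟩ = ((φ (ιA S T X ⟨y.shift ν, ⟨0, h0⟩⟩) : lieSU (Fin 2)) : Matrix (Fin 2) (Fin 2) ℂ) ∧
        Q k (fun b => (w' b : Matrix (Fin 2) (Fin 2) ℂ)) ⟨y, ν⟩ = ((φ (ιA S T X ⟨y, ν⟩) : lieSU (Fin 2)) : Matrix (Fin 2) (Fin 2) ℂ)) →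
      ((P.L : ℝ) ^ P.d) ^ k / (((P.L : ℝ)) ^ 2 * (P.L : ℝ) ^ 2) ^ k *
          ∑ z ∈ box m lo, ∑ μ : Fin P.d, ∑ a : Fin 3, curl (fun b => ιA S T X (⟨castSite b.1, b.2⟩ : PBond P k) a) z ⟨0, h0⟩ μ ^ 2
        ≤ fderiv ℝ (fun Y => fderiv ℝ (fun Y : PBond P 0 → lieSU (Fin 2) => wilsonAction4 (expChart (1 : GaugeField P 0 (SU 2)) Y)) Y) 0 w' w' :=
  fun w' hrep => gamma0_circ_le_flatHessian_of_reproduce h0 hk X lo hm Sset hwin hS Q hQ0 hQs hφ w' hrep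

end Binder

end Summit.QuantumFields.YangMills.BalabanUVNodes.N12NearFlatFederbushFibre

end
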